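import Literature.Geometry.Symplectic.SphereCROperatorPointwise
import Literature.Geometry.Symplectic.JHolomorphicRegularityHolder
import Literature.Analysis.Complex.CauchyTransformHolder
import Literature.Analysis.FunctionSpaces.ContDiffHolderNemytskii
import HarnessLib

/-!
# Elliptic regularity of the solutions of the chart equation `crExpr J₀ (vmap₀ ξ f) = 0`

Layer B7a of the analytic core of the Hofer–Lizan–Sikorav local foliation theorem (Wendl 2018,
Thm. 2.46 / Prop. 2.53), as used by the lead of crux `WitnessCharge` (summit `SmoothPoincare4`).
A map from the Riemann sphere into `ℂℙ¹ × ℂ` close to the zero section is described, in the chart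
`0`, by a vector field `ξ₀` and a function `f₀` through
`vmap₀ ξ₀ f₀ z = (expChart z (ξ₀ z), Q₀(z)⁻¹ (f₀ z))` (`SphereCROperatorPointwise`). The implicit
function theorem produces `ξ₀, f₀` in a HÖLDER class `C^{1,r}`, `0 < r < 1`, solving the
nonlinear Cauchy–Riemann equation `crExpr J₀ (vmap₀ ξ₀ f₀) = 0` near a point `z₀`. We prove that
such solutions are `C^∞` at `z₀` (`contDiffAt_of_crExpr_vmap₀_eq_zero`) and, more precisely, of
every local Hölder class `C^{m,r}` near `z₀` (`locHolder_of_crExpr_vmap₀_eq_zero`).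

Proof. Transport `v = vmap₀ ξ₀ f₀ : ℂ → ℂ × ℂ` to `ℝ⁴` by a fixed real-linear isomorphism
`L : ℂ × ℂ ≃ ℝ⁴`; then `u = L ∘ v` solves the first-order system `∂ₓ u + A ∂_y u = 0` with
`A = L ∘ J₀(v) ∘ L⁻¹`, `A² = -1`, whose coefficients have the local Hölder class of `u`; the tree's
bootstrapping `locHolder_succ_of_linearCR` (McDuff–Salamon 2012, Thm. B.4.1, Hölder version, with
the Cauchy-transform estimate `cauchyTransformHolderApriori_of_lt_one`) raises that class
indefinitely. Finally `ξ₀ z = expChartInv z (v z).1` and `f₀ z = Q₀ z (v z).2` near `z₀`, where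
`expChartInv z` is the (explicit, smooth) inverse of the exponential chart `expChart z` in the
fibre variable.

## Contents

* `expChartInv`, `expChartInv_expChart`, `expChart_expChartInv`, `contDiffAt_expChartInv` — the
  inverse of the exponential chart in the fibre variable;
* `locHolder_comp_of_contDiffOn` — maps `z ↦ Φ (z, u z)` with `Φ` smooth near `(z₀, u z₀)` and `u`
  of local class `C^{k,r}` near `z₀` are of local class `C^{k,r}` near `z₀`;
* `locHolder_vmap₀` — `vmap₀ ξ₀ f₀` has the local class of `(ξ₀, f₀)`;
* `locHolder_toE4_vmap₀_of_crExpr_eq_zero` — the bootstrapping;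
* `contDiffAt_vmap₀_of_crExpr_eq_zero`, `contDiffAt_of_crExpr_vmap₀_eq_zero` (MAIN),
  `locHolder_of_crExpr_vmap₀_eq_zero`.

## References

* D. McDuff, D. Salamon, *J-holomorphic Curves and Symplectic Topology*, 2nd ed. (2012), App. B.4,
  Thm. B.4.1. [McDuffSalamon2012]
* C. Wendl, *Holomorphic Curves in Low Dimensions*, LNM 2216 (2018), §2.3, Thm. 2.46. [Wendl2018]
-/

noncomputable section

open Complex Set Filter Function
open scoped Topology NNReal ContDiff ComplexConjugate
open Literature.Analysis.Complex Literature.Analysis.Complex.ProjectiveLineExpChart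
  Literature.Analysis.FunctionSpaces Literature.Geometry.Symplectic.CRExpression

namespace Literature.Geometry.Symplectic

/-! ### Local Hölder classes of `z ↦ Φ (z, u z)` -/

section LocHolderComp

variable {Y Z : Type} [NormedAddCommGroup Y] [NormedSpace ℝ Y] [FiniteDimensional ℝ Y]
  [NormedAddCommGroup Z] [NormedSpace ℝ Z] {r : ℝ≥0} {z₀ : ℂ}

/-- A `C^∞` modification of the identity of `ℂ` with compact support, equal to the identity near
a given point. [folklore] -/
theorem exists_contDiff_hasCompactSupport_eventuallyEq_id (z₀ : ℂ) :
    ∃ ι : ℂ → ℂ, ContDiff ℝ ∞ ι ∧ HasCompactSupport ι ∧ ι =ᶠ[𝓝 z₀] id := by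
  obtain ⟨χ, hχ, hχs, -, hχ1, -⟩ := exists_contDiff_one_nhdsSet_of_isCompact
    (isCompact_singleton (x := z₀)) isOpen_univ (subset_univ _)
  rw [nhdsSet_singleton] at hχ1
  refine ⟨fun z => χ z • z, hχ.smul contDiff_id, hχs.smul_right, ?_⟩
  filter_upwards [hχ1] with z hz
  simp [hz]

omit [FiniteDimensional ℝ Y] in
/-- **Pairs** of maps of local class `C^{k,r}`. [folklore] -/
theorem locHolder_prodMk {Y' : Type} [NormedAddCommGroup Y'] [NormedSpace ℝ Y'] {k : ℕ}
    {u : ℂ → Y} {u' : ℂ → Y'} (hu : ∃ W, MemContDiffHolder k r W ∧ W =ᶠ[𝓝 z₀] u)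
    (hu' : ∃ W, MemContDiffHolder k r W ∧ W =ᶠ[𝓝 z₀] u') :
    ∃ W, MemContDiffHolder k r W ∧ W =ᶠ[𝓝 z₀] fun z => (u z, u' z) := by
  obtain ⟨W, hW, hWu⟩ := hu
  obtain ⟨W', hW', hWu'⟩ := hu'
  refine ⟨fun z => (W z, W' z), hW.prodMk hW', ?_⟩
  filter_upwards [hWu, hWu'] with z hz hz'
  rw [hz, hz']

/-- **Local Hölder classes of `z ↦ Φ (z, u z)`.** If `Φ : ℂ × Y → Z` is `C^∞` on an open set `U`
containing `(z₀, u z₀)` (`Y` finite-dimensional) and `u` is of local class `C^{k,r}` near `z₀`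
(`r ≤ 1`), then `z ↦ Φ (z, u z)` is of local class `C^{k,r}` near `z₀`. Proof: cut `Φ` off to a
globally smooth map equal to `Φ` near `(z₀, u z₀)`, replace `z` by a compactly supported smooth
modification of the identity, and apply the Nemytskii property `MemContDiffHolder.comp_left`.
[folklore] -/
theorem locHolder_comp_of_contDiffOn (hr : r ≤ 1) {k : ℕ} {Φ : ℂ × Y → Z} {U : Set (ℂ × Y)}
    (hU : IsOpen U) (hΦ : ContDiffOn ℝ ∞ Φ U) {u : ℂ → Y} (h0 : (z₀, u z₀) ∈ U)
    (hu : ∃ W, MemContDiffHolder k r W ∧ W =ᶠ[𝓝 z₀] u) :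
    ∃ W, MemContDiffHolder k r W ∧ W =ᶠ[𝓝 z₀] fun z => Φ (z, u z) := by
  obtain ⟨W, hW, hWu⟩ := hu
  -- a cutoff near the point and the globalised map
  obtain ⟨χ, hχ, -, hχU, hχ1, -⟩ := exists_contDiff_one_nhdsSet_of_isCompact
    (isCompact_singleton (x := (z₀, u z₀))) hU (singleton_subset_iff.2 h0)
  rw [nhdsSet_singleton] at hχ1
  have hΦ' : ContDiff ℝ ∞ fun p => χ p • Φ p := ContDiff.smul_of_contDiffOn hχ hU hΦ hχU
  -- the identity cut off, and the member `z ↦ (ι z, W z)`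
  obtain ⟨ι, hι, hιs, hιid⟩ := exists_contDiff_hasCompactSupport_eventuallyEq_id z₀
  have hιmem : MemContDiffHolder k r ι :=
    MemContDiffHolder.of_contDiff_of_hasCompactSupport hι hιs hr
  have hT : MemContDiffHolder k r fun z => (ι z, W z) := hιmem.prodMk hW
  refine ⟨_, hT.comp_left hr (hΦ'.of_le (by exact_mod_cast le_top)), ?_⟩
  -- the composite agrees with `z ↦ Φ (z, u z)` near `z₀`
  have hWz₀ : W z₀ = u z₀ := hWu.eq_of_nhds
  have hcont : Tendsto (fun z => (z, W z)) (𝓝 z₀) (𝓝 (z₀, u z₀)) := by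
    rw [← hWz₀]
    exact (continuousAt_id.prodMk hW.contDiff.continuous.continuousAt).tendsto
  filter_upwards [hWu, hιid, hcont.eventually hχ1] with z hz hιz hχz
  have hιz' : ι z = z := hιz
  rw [comp_apply, hιz', hχz, one_smul, hz]

/-- `locHolder_comp_of_contDiffOn` for a globally smooth `Φ`. [folklore] -/
theorem locHolder_comp_of_contDiff (hr : r ≤ 1) {k : ℕ} {Φ : ℂ × Y → Z} (hΦ : ContDiff ℝ ∞ Φ)
    {u : ℂ → Y} (hu : ∃ W, MemContDiffHolder k r W ∧ W =ᶠ[𝓝 z₀] u) :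
    ∃ W, MemContDiffHolder k r W ∧ W =ᶠ[𝓝 z₀] fun z => Φ (z, u z) :=
  locHolder_comp_of_contDiffOn hr isOpen_univ hΦ.contDiffOn (mem_univ _) hu

omit [FiniteDimensional ℝ Y] in
/-- Transfer of a local Hölder class along an eventual equality. [folklore] -/
theorem locHolder_congr {k : ℕ} {u u' : ℂ → Y}
    (hu : ∃ W, MemContDiffHolder k r W ∧ W =ᶠ[𝓝 z₀] u) (h : u =ᶠ[𝓝 z₀] u') :
    ∃ W, MemContDiffHolder k r W ∧ W =ᶠ[𝓝 z₀] u' := by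
  obtain ⟨W, hW, hWu⟩ := hu
  exact ⟨W, hW, hWu.trans h⟩

end LocHolderComp

namespace SphereCR

/-! ### The inverse of the exponential chart in the fibre variable -/

/-- **The inverse of the exponential chart in the fibre variable**: for fixed `z`, the tangent
vector `c ∂_z` with `expChart z c = Z` is `expChartInv z Z = (1 + |z|²) (Z - z) / (1 + Z conj z)`
(`expChartInv_expChart`, `expChart_expChartInv`). Junk value where `1 + Z conj z = 0`, i.e. where
`Z` is antipodal to `z`. [folklore] -/
def expChartInv (z Z : ℂ) : ℂ :=
  (1 + (Complex.normSq z : ℂ)) * (Z - z) / (1 + Z * (starRingEnd ℂ) z)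

/-- With `D = 1 + |z|²`: `1 + expChart z c * conj z = D² / den z c`. [folklore] -/
theorem one_add_expChart_mul_conj {z c : ℂ} (h : den z c ≠ 0) :
    1 + expChart z c * conj z = (1 + (Complex.normSq z : ℂ)) ^ 2 / den z c := by
  rw [eq_div_iff h, expChart, add_mul, one_mul, div_mul_eq_mul_div, div_mul_cancel₀ _ h, den,
    ← Complex.mul_conj]
  ring

/-- `1 + expChart z c * conj z ≠ 0` wherever `den z c ≠ 0`: the image of the exponential chart at
`z` avoids the antipode of `z`. [folklore] -/
theorem one_add_expChart_mul_conj_ne_zero {z c : ℂ} (h : den z c ≠ 0) :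
    1 + expChart z c * conj z ≠ 0 := by
  rw [one_add_expChart_mul_conj h]
  exact div_ne_zero (pow_ne_zero 2 (one_add_normSq_ne_zero z)) h

/-- **`expChartInv z` inverts `expChart z`**: `expChartInv z (expChart z c) = c` wherever
`den z c ≠ 0`. [folklore] -/
theorem expChartInv_expChart {z c : ℂ} (h : den z c ≠ 0) : expChartInv z (expChart z c) = c := by
  have hD : (1 + (Complex.normSq z : ℂ)) ≠ 0 := one_add_normSq_ne_zero z
  have hsub : expChart z c - z = c * (1 + (Complex.normSq z : ℂ)) / den z c := expChart_sub_self h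
  rw [expChartInv, one_add_expChart_mul_conj h, hsub]
  field_simp

/-- With `D = 1 + |z|²` and `c = expChartInv z Z`: `den z c = D² / (1 + Z conj z)`. [folklore] -/
theorem den_expChartInv {z Z : ℂ} (h : 1 + Z * conj z ≠ 0) :
    den z (expChartInv z Z) = (1 + (Complex.normSq z : ℂ)) ^ 2 / (1 + Z * conj z) := by
  rw [eq_div_iff h, den, expChartInv, sub_mul, div_mul_eq_mul_div, div_mul_cancel₀ _ h,
    ← Complex.mul_conj]
  ring

/-- **`expChart z` inverts `expChartInv z`**: `expChart z (expChartInv z Z) = Z` wherever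
`1 + Z conj z ≠ 0`. [folklore] -/
theorem expChart_expChartInv {z Z : ℂ} (h : 1 + Z * conj z ≠ 0) :
    expChart z (expChartInv z Z) = Z := by
  have hD : (1 + (Complex.normSq z : ℂ)) ^ 2 ≠ 0 := pow_ne_zero 2 (one_add_normSq_ne_zero z)
  have hnum : z * (1 + (Complex.normSq z : ℂ)) + expChartInv z Z =
      (1 + (Complex.normSq z : ℂ)) ^ 2 * Z / (1 + Z * conj z) := by
    rw [eq_div_iff h, expChartInv, add_mul, div_mul_cancel₀ _ h, ← Complex.mul_conj]
    ring
  rw [expChart, hnum, den_expChartInv h, div_div_div_cancel_right₀ h, mul_div_cancel_left₀ _ hD]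

/-- Where `1 + Z conj z ≠ 0`, the denominator of the exponential chart does not vanish at
`(z, expChartInv z Z)`. [folklore] -/
theorem den_expChartInv_ne_zero {z Z : ℂ} (h : 1 + Z * conj z ≠ 0) :
    den z (expChartInv z Z) ≠ 0 := by
  rw [den_expChartInv h]
  exact div_ne_zero (pow_ne_zero 2 (one_add_normSq_ne_zero z)) h

/-- `expChartInv` is real-analytic in `(z, Z)` wherever `1 + Z conj z ≠ 0`. [folklore] -/
theorem analyticAt_expChartInv {p : ℂ × ℂ} (h : 1 + p.2 * conj p.1 ≠ 0) :
    AnalyticAt ℝ (fun q : ℂ × ℂ => expChartInv q.1 q.2) p := by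
  have hn : AnalyticAt ℝ (fun q : ℂ × ℂ => (1 + (Complex.normSq q.1 : ℂ)) * (q.2 - q.1)) p := by
    have h' : (fun q : ℂ × ℂ => (1 + (Complex.normSq q.1 : ℂ)) * (q.2 - q.1))
        = fun q => (1 + q.1 * conj q.1) * (q.2 - q.1) := by
      funext q; simp only [Complex.mul_conj]
    rw [h']
    exact (analyticAt_const.add (analyticAt_fst.mul (analyticAt_conj_fst p))).mul
      (analyticAt_snd.sub analyticAt_fst)
  have hd : AnalyticAt ℝ (fun q : ℂ × ℂ => 1 + q.2 * conj q.1) p :=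
    analyticAt_const.add (analyticAt_snd.mul (analyticAt_conj_fst p))
  exact hn.fun_div hd h

/-- **Smoothness of the inverse chart**: `expChartInv` is `C^n` in `(z, Z)`, for every `n`, at
every point where `1 + Z conj z ≠ 0`. [folklore] -/
theorem contDiffAt_expChartInv {n : WithTop ℕ∞} {p : ℂ × ℂ} (h : 1 + p.2 * conj p.1 ≠ 0) :
    ContDiffAt ℝ n (fun q : ℂ × ℂ => expChartInv q.1 q.2) p :=
  (analyticAt_expChartInv h).contDiffAt

/-- The domain `{(z, Z) | 1 + Z conj z ≠ 0}` of the inverse chart is open. [folklore] -/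
theorem isOpen_one_add_mul_conj_ne_zero : IsOpen {p : ℂ × ℂ | 1 + p.2 * conj p.1 ≠ 0} :=
  isOpen_ne_fun (continuous_const.add (continuous_snd.mul (Complex.continuous_conj.comp
    continuous_fst))) continuous_const


/-! ### The model space `ℝ⁴` -/

/-- A fixed real-linear identification `ℂ × ℂ ≃ ℝ⁴` (the bootstrapping
`locHolder_succ_of_linearCR` is stated on `EuclideanSpace ℝ (Fin 4)`). [folklore] -/
def toE4 : (ℂ × ℂ) ≃L[ℝ] EuclideanSpace ℝ (Fin 4) :=
  ContinuousLinearEquiv.ofFinrankEq (by simp)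

namespace SphereACData

variable (𝒥 : SphereACData)

/-! ### The local Hölder class of `vmap₀ ξ₀ f₀` -/

/-- The chart-`0` map as a function of the point data: `(z, c, t) ↦ (expChart z c, Q₀(z)⁻¹ t)`.
[cite: Wendl2018, §2.3] -/
def vmapPt₀ (p : ℂ × (ℂ × ℂ)) : ℂ × ℂ := (expChart p.1 p.2.1, 𝒥.Qinv₀ p.1 p.2.2)

/-- `vmap₀ ξ₀ f₀ z = vmapPt₀ (z, ξ₀ z, f₀ z)`. [folklore] -/
theorem vmap₀_eq_vmapPt₀ (ξ₀ f₀ : ℂ → ℂ) (z : ℂ) :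
    𝒥.vmap₀ ξ₀ f₀ z = 𝒥.vmapPt₀ (z, (ξ₀ z, f₀ z)) := rfl

/-- The domain `{den z c ≠ 0}` of `vmapPt₀` is open. [folklore] -/
theorem isOpen_vmapPt₀_dom : IsOpen {p : ℂ × (ℂ × ℂ) | den p.1 p.2.1 ≠ 0} :=
  isOpen_ne_fun (continuous_den.comp (continuous_fst.prodMk continuous_snd.fst)) continuous_const

/-- `vmapPt₀` is `C^∞` on `{den z c ≠ 0}`. [folklore] -/
theorem contDiffOn_vmapPt₀ : ContDiffOn ℝ ∞ 𝒥.vmapPt₀ {p : ℂ × (ℂ × ℂ) | den p.1 p.2.1 ≠ 0} := by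
  intro p hp
  refine ContDiffAt.contDiffWithinAt (ContDiffAt.prodMk ?_ ?_)
  · exact (contDiffAt_expChart (p := (p.1, p.2.1)) hp).comp p
      (contDiffAt_fst.prodMk contDiffAt_snd.fst)
  · exact ((𝒥.contDiff_Qinv₀_and.1.comp contDiff_fst).clm_apply contDiff_snd.snd).contDiffAt

/-- **`vmap₀ ξ₀ f₀` has the local Hölder class of `(ξ₀, f₀)`** near any point `z₀` with
`den z₀ (ξ₀ z₀) ≠ 0` (`r ≤ 1`). [folklore] -/
theorem locHolder_vmap₀ {r : ℝ≥0} (hr : r ≤ 1) {k : ℕ} {ξ₀ f₀ : ℂ → ℂ} {z₀ : ℂ}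
    (hξ : ∃ W : ℂ → ℂ, MemContDiffHolder k r W ∧ W =ᶠ[𝓝 z₀] ξ₀)
    (hf : ∃ W : ℂ → ℂ, MemContDiffHolder k r W ∧ W =ᶠ[𝓝 z₀] f₀) (hden : den z₀ (ξ₀ z₀) ≠ 0) :
    ∃ W : ℂ → ℂ × ℂ, MemContDiffHolder k r W ∧ W =ᶠ[𝓝 z₀] 𝒥.vmap₀ ξ₀ f₀ :=
  locHolder_comp_of_contDiffOn hr isOpen_vmapPt₀_dom 𝒥.contDiffOn_vmapPt₀
    (u := fun z => (ξ₀ z, f₀ z)) hden (locHolder_prodMk hξ hf)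

/-! ### The transported equation and the bootstrapping -/

/-- The coefficients of the transported equation as a function of the point of `ℂ × ℂ`:
`x ↦ L ∘ J₀ x ∘ L⁻¹`. [folklore] -/
def coefE4 (x : ℂ × ℂ) : EuclideanSpace ℝ (Fin 4) →L[ℝ] EuclideanSpace ℝ (Fin 4) :=
  (toE4 : ℂ × ℂ →L[ℝ] EuclideanSpace ℝ (Fin 4)).comp
    ((𝒥.J₀ x).comp (toE4.symm : EuclideanSpace ℝ (Fin 4) →L[ℝ] ℂ × ℂ))

/-- `coefE4` is smooth. [folklore] -/
theorem contDiff_coefE4 : ContDiff ℝ ∞ 𝒥.coefE4 :=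
  ContDiff.clm_comp contDiff_const (ContDiff.clm_comp 𝒥.smooth₀ contDiff_const)

/-- `coefE4 x` is a linear complex structure: `(coefE4 x)² = -1`. [folklore] -/
theorem coefE4_sq (x : ℂ × ℂ) (w : EuclideanSpace ℝ (Fin 4)) : 𝒥.coefE4 x (𝒥.coefE4 x w) = -w := by
  simp [coefE4, 𝒥.sq₀]

/-- **The transported equation**: if `crExpr J₀ v = 0` near `z₀` then `u = L ∘ v` solves
`∂ₓ u + coefE4 (v z) ∂_y u = 0` near `z₀`. [folklore] -/
theorem linearCR_toE4_of_crExpr_eq_zero {v : ℂ → ℂ × ℂ} {z₀ : ℂ}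
    (hsol : ∀ᶠ z in 𝓝 z₀, crExpr 𝒥.J₀ v z = 0) :
    ∀ᶠ z in 𝓝 z₀, fderiv ℝ (toE4 ∘ v) z 1 + 𝒥.coefE4 (v z) (fderiv ℝ (toE4 ∘ v) z I) = 0 := by
  filter_upwards [hsol] with z hz
  rw [ContinuousLinearEquiv.comp_fderiv]
  simp only [coefE4, ContinuousLinearMap.coe_comp, comp_apply, ContinuousLinearEquiv.coe_coe,
    ContinuousLinearEquiv.symm_apply_apply]
  rw [← map_add, ← crExpr_def, hz, map_zero]

/-- **The bootstrapping.** Let `0 < r < 1`, let `ξ₀, f₀` be of local class `C^{1,r}` near `z₀`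
with `den z₀ (ξ₀ z₀) ≠ 0`, and assume `crExpr J₀ (vmap₀ ξ₀ f₀) = 0` near `z₀`. Then the
transported map `L ∘ vmap₀ ξ₀ f₀ : ℂ → ℝ⁴` is of local class `C^{k+1,r}` near `z₀` for every `k`
(induction on `k` with `locHolder_succ_of_linearCR`, the coefficients `coefE4 ∘ vmap₀ ξ₀ f₀`
having the class of the map). [cite: McDuffSalamon2012, Thm B.4.1] -/
theorem locHolder_toE4_vmap₀_of_crExpr_eq_zero {r : ℝ≥0} (hr0 : 0 < r) (hr1 : r < 1)
    {ξ₀ f₀ : ℂ → ℂ} {z₀ : ℂ} (hξ : ∃ W : ℂ → ℂ, MemContDiffHolder 1 r W ∧ W =ᶠ[𝓝 z₀] ξ₀)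
    (hf : ∃ W : ℂ → ℂ, MemContDiffHolder 1 r W ∧ W =ᶠ[𝓝 z₀] f₀) (hden : den z₀ (ξ₀ z₀) ≠ 0)
    (hsol : ∀ᶠ z in 𝓝 z₀, crExpr 𝒥.J₀ (𝒥.vmap₀ ξ₀ f₀) z = 0) (k : ℕ) :
    ∃ W, MemContDiffHolder (k + 1) r W ∧ W =ᶠ[𝓝 z₀] (toE4 ∘ 𝒥.vmap₀ ξ₀ f₀) := by
  have hr1' : r ≤ 1 := hr1.le
  have hT : CauchyTransformHolderApriori (ℂ × ℂ) r :=
    cauchyTransformHolderApriori_of_lt_one (ℂ × ℂ) hr0 hr1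
  set v : ℂ → ℂ × ℂ := 𝒥.vmap₀ ξ₀ f₀
  have hv1 : ∃ W, MemContDiffHolder 1 r W ∧ W =ᶠ[𝓝 z₀] v := 𝒥.locHolder_vmap₀ hr1' hξ hf hden
  have hA2 : ∀ z w, 𝒥.coefE4 (v z) (𝒥.coefE4 (v z) w) = -w := fun z w => 𝒥.coefE4_sq _ _
  have heq : ∀ᶠ z in 𝓝 z₀, fderiv ℝ (toE4 ∘ v) z 1 + 𝒥.coefE4 (v z) (fderiv ℝ (toE4 ∘ v) z I) =
      (fun _ => (0 : EuclideanSpace ℝ (Fin 4))) z := 𝒥.linearCR_toE4_of_crExpr_eq_zero hsol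
  induction k with
  | zero => exact locHolder_comp_left hr1' toE4.contDiff hv1
  | succ k ih =>
    -- `v = L⁻¹ ∘ u` and the coefficients have the class of `u`
    have hvk : ∃ W, MemContDiffHolder (k + 1) r W ∧ W =ᶠ[𝓝 z₀] v := by
      have h := locHolder_comp_left hr1' toE4.symm.contDiff ih
      simpa using h
    have hA : ∃ W, MemContDiffHolder (k + 1) r W ∧ W =ᶠ[𝓝 z₀] fun z => 𝒥.coefE4 (v z) :=
      locHolder_comp_left hr1' 𝒥.contDiff_coefE4 hvk
    have hu1 : ∃ W, MemContDiffHolder 1 r W ∧ W =ᶠ[𝓝 z₀] (toE4 ∘ v) :=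
      locHolder_of_le hr1' (Nat.le_add_left 1 k) ih
    exact locHolder_succ_of_linearCR hr0 hr1 hT hA2 k (toE4 ∘ v) (fun _ => 0) hA hu1
      (locHolder_zero _) heq

/-- The chart-`0` map of a `C^{1,r}` solution of `crExpr J₀ (vmap₀ ξ₀ f₀) = 0` near `z₀` is of
every local Hölder class `C^{m,r}` near `z₀`. [cite: McDuffSalamon2012, Thm B.4.1] -/
theorem locHolder_vmap₀_of_crExpr_eq_zero {r : ℝ≥0} (hr0 : 0 < r) (hr1 : r < 1)
    {ξ₀ f₀ : ℂ → ℂ} {z₀ : ℂ} (hξ : ∃ W : ℂ → ℂ, MemContDiffHolder 1 r W ∧ W =ᶠ[𝓝 z₀] ξ₀)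
    (hf : ∃ W : ℂ → ℂ, MemContDiffHolder 1 r W ∧ W =ᶠ[𝓝 z₀] f₀) (hden : den z₀ (ξ₀ z₀) ≠ 0)
    (hsol : ∀ᶠ z in 𝓝 z₀, crExpr 𝒥.J₀ (𝒥.vmap₀ ξ₀ f₀) z = 0) (m : ℕ) :
    ∃ W : ℂ → ℂ × ℂ, MemContDiffHolder m r W ∧ W =ᶠ[𝓝 z₀] 𝒥.vmap₀ ξ₀ f₀ := by
  have hu : ∃ W, MemContDiffHolder m r W ∧ W =ᶠ[𝓝 z₀] (toE4 ∘ 𝒥.vmap₀ ξ₀ f₀) :=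
    locHolder_of_succ hr1.le (𝒥.locHolder_toE4_vmap₀_of_crExpr_eq_zero hr0 hr1 hξ hf hden hsol m)
  have h := locHolder_comp_left hr1.le toE4.symm.contDiff hu
  simpa using h

/-- The chart-`0` map of a `C^{1,r}` solution of `crExpr J₀ (vmap₀ ξ₀ f₀) = 0` near `z₀` is `C^∞`
at `z₀`. [cite: McDuffSalamon2012, Thm B.4.1] -/
theorem contDiffAt_vmap₀_of_crExpr_eq_zero {r : ℝ≥0} (hr0 : 0 < r) (hr1 : r < 1)
    {ξ₀ f₀ : ℂ → ℂ} {z₀ : ℂ} (hξ : ∃ W : ℂ → ℂ, MemContDiffHolder 1 r W ∧ W =ᶠ[𝓝 z₀] ξ₀)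
    (hf : ∃ W : ℂ → ℂ, MemContDiffHolder 1 r W ∧ W =ᶠ[𝓝 z₀] f₀) (hden : den z₀ (ξ₀ z₀) ≠ 0)
    (hsol : ∀ᶠ z in 𝓝 z₀, crExpr 𝒥.J₀ (𝒥.vmap₀ ξ₀ f₀) z = 0) :
    ContDiffAt ℝ ∞ (𝒥.vmap₀ ξ₀ f₀) z₀ := by
  rw [contDiffAt_infty]
  intro n
  exact (eventually_contDiffAt_of_locHolder
    (𝒥.locHolder_vmap₀_of_crExpr_eq_zero hr0 hr1 hξ hf hden hsol n)).self_of_nhds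

/-! ### Regularity of `ξ₀` and `f₀` -/

/-- Near a point `z₀` where `ξ₀` is of some local Hölder class (in particular continuous) and
`den z₀ (ξ₀ z₀) ≠ 0`, the vector field is recovered from the chart-`0` map by the inverse chart:
`ξ₀ z = expChartInv z (vmap₀ ξ₀ f₀ z).1` near `z₀`. [folklore] -/
theorem eventuallyEq_expChartInv_vmap₀ {r : ℝ≥0} {k : ℕ} {ξ₀ : ℂ → ℂ} (f₀ : ℂ → ℂ) {z₀ : ℂ}
    (hξ : ∃ W : ℂ → ℂ, MemContDiffHolder k r W ∧ W =ᶠ[𝓝 z₀] ξ₀) (hden : den z₀ (ξ₀ z₀) ≠ 0) :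
    ξ₀ =ᶠ[𝓝 z₀] fun z => expChartInv z (𝒥.vmap₀ ξ₀ f₀ z).1 := by
  have hc : ContinuousAt ξ₀ z₀ := (eventually_contDiffAt_of_locHolder hξ).self_of_nhds.continuousAt
  have hev : ∀ᶠ z in 𝓝 z₀, den z (ξ₀ z) ≠ 0 :=
    (continuousAt_id.prodMk hc).eventually_mem (isOpen_den_ne_zero.mem_nhds hden)
  filter_upwards [hev] with z hz
  exact (expChartInv_expChart hz).symm

/-- The function is recovered from the chart-`0` map by the normaliser:
`f₀ z = Q₀ z (vmap₀ ξ₀ f₀ z).2`. [folklore] -/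
theorem Q₀_vmap₀_snd (ξ₀ f₀ : ℂ → ℂ) (z : ℂ) : 𝒥.Q₀ z (𝒥.vmap₀ ξ₀ f₀ z).2 = f₀ z := by
  simp [vmap₀]

/-- **Elliptic regularity of the solutions of the chart equation.** Let `0 < r < 1`, let
`ξ₀, f₀ : ℂ → ℂ` be of local class `C^{1,r}` near `z₀` with `den z₀ (ξ₀ z₀) ≠ 0` (the map stays in
the chart), and assume that the chart-`0` map `vmap₀ ξ₀ f₀ = (expChart · (ξ₀ ·), Q₀(·)⁻¹ (f₀ ·))` is
`J₀`-holomorphic near `z₀`: `crExpr J₀ (vmap₀ ξ₀ f₀) = 0` near `z₀`. Then `ξ₀` and `f₀` are `C^∞`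
at `z₀`. [cite: McDuffSalamon2012, Thm B.4.1] -/
theorem contDiffAt_of_crExpr_vmap₀_eq_zero {r : ℝ≥0} (hr0 : 0 < r) (hr1 : r < 1)
    {ξ₀ f₀ : ℂ → ℂ} {z₀ : ℂ} (hξ : ∃ W : ℂ → ℂ, MemContDiffHolder 1 r W ∧ W =ᶠ[𝓝 z₀] ξ₀)
    (hf : ∃ W : ℂ → ℂ, MemContDiffHolder 1 r W ∧ W =ᶠ[𝓝 z₀] f₀) (hden : den z₀ (ξ₀ z₀) ≠ 0)
    (hsol : ∀ᶠ z in 𝓝 z₀, crExpr 𝒥.J₀ (𝒥.vmap₀ ξ₀ f₀) z = 0) :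
    ContDiffAt ℝ ∞ ξ₀ z₀ ∧ ContDiffAt ℝ ∞ f₀ z₀ := by
  have hv := 𝒥.contDiffAt_vmap₀_of_crExpr_eq_zero hr0 hr1 hξ hf hden hsol
  constructor
  · have h1 : 1 + (𝒥.vmap₀ ξ₀ f₀ z₀).1 * conj z₀ ≠ 0 := one_add_expChart_mul_conj_ne_zero hden
    have h2 : ContDiffAt ℝ ∞ (fun z => expChartInv z (𝒥.vmap₀ ξ₀ f₀ z).1) z₀ :=
      (contDiffAt_expChartInv (p := (z₀, (𝒥.vmap₀ ξ₀ f₀ z₀).1)) h1).comp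
        (f := fun z => (z, (𝒥.vmap₀ ξ₀ f₀ z).1)) z₀ (contDiffAt_id.prodMk hv.fst)
    exact h2.congr_of_eventuallyEq (𝒥.eventuallyEq_expChartInv_vmap₀ f₀ hξ hden)
  · have h2 : ContDiffAt ℝ ∞ (fun z => 𝒥.Q₀ z (𝒥.vmap₀ ξ₀ f₀ z).2) z₀ :=
      𝒥.contDiff_Q₀.contDiffAt.clm_apply hv.snd
    have h3 : (fun z => 𝒥.Q₀ z (𝒥.vmap₀ ξ₀ f₀ z).2) = f₀ := funext (𝒥.Q₀_vmap₀_snd ξ₀ f₀)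
    rwa [h3] at h2

/-- **All local Hölder classes of the solutions of the chart equation.** Under the hypotheses of
`contDiffAt_of_crExpr_vmap₀_eq_zero`, `ξ₀` and `f₀` are of local class `C^{m,r}` near `z₀` for
every `m`. [cite: McDuffSalamon2012, Thm B.4.1] -/
theorem locHolder_of_crExpr_vmap₀_eq_zero {r : ℝ≥0} (hr0 : 0 < r) (hr1 : r < 1)
    {ξ₀ f₀ : ℂ → ℂ} {z₀ : ℂ} (hξ : ∃ W : ℂ → ℂ, MemContDiffHolder 1 r W ∧ W =ᶠ[𝓝 z₀] ξ₀)
    (hf : ∃ W : ℂ → ℂ, MemContDiffHolder 1 r W ∧ W =ᶠ[𝓝 z₀] f₀) (hden : den z₀ (ξ₀ z₀) ≠ 0)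
    (hsol : ∀ᶠ z in 𝓝 z₀, crExpr 𝒥.J₀ (𝒥.vmap₀ ξ₀ f₀) z = 0) (m : ℕ) :
    (∃ W : ℂ → ℂ, MemContDiffHolder m r W ∧ W =ᶠ[𝓝 z₀] ξ₀) ∧
      ∃ W : ℂ → ℂ, MemContDiffHolder m r W ∧ W =ᶠ[𝓝 z₀] f₀ := by
  have hr1' : r ≤ 1 := hr1.le
  have hv := 𝒥.locHolder_vmap₀_of_crExpr_eq_zero hr0 hr1 hξ hf hden hsol m
  constructor
  · -- `ξ₀ z = expChartInv z (v z).1` near `z₀`, a smooth function of `(z, v z)` near `(z₀, v z₀)`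
    have hU : IsOpen {p : ℂ × (ℂ × ℂ) | 1 + p.2.1 * conj p.1 ≠ 0} :=
      isOpen_one_add_mul_conj_ne_zero.preimage (continuous_fst.prodMk continuous_snd.fst)
    have hΦ : ContDiffOn ℝ ∞ (fun p : ℂ × (ℂ × ℂ) => expChartInv p.1 p.2.1)
        {p : ℂ × (ℂ × ℂ) | 1 + p.2.1 * conj p.1 ≠ 0} := fun p hp =>
      ((contDiffAt_expChartInv (p := (p.1, p.2.1)) hp).comp p
        (contDiffAt_fst.prodMk contDiffAt_snd.fst)).contDiffWithinAt
    have h0 : 1 + (𝒥.vmap₀ ξ₀ f₀ z₀).1 * conj z₀ ≠ 0 := one_add_expChart_mul_conj_ne_zero hden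
    exact locHolder_congr (locHolder_comp_of_contDiffOn hr1' hU hΦ (u := 𝒥.vmap₀ ξ₀ f₀) h0 hv)
      (𝒥.eventuallyEq_expChartInv_vmap₀ f₀ hξ hden).symm
  · have hΦ : ContDiff ℝ ∞ fun p : ℂ × (ℂ × ℂ) => 𝒥.Q₀ p.1 p.2.2 :=
      (𝒥.contDiff_Q₀.comp contDiff_fst).clm_apply contDiff_snd.snd
    have h := locHolder_comp_of_contDiff hr1' hΦ (u := 𝒥.vmap₀ ξ₀ f₀) hv
    have h3 : (fun z => 𝒥.Q₀ z (𝒥.vmap₀ ξ₀ f₀ z).2) = f₀ := funext (𝒥.Q₀_vmap₀_snd ξ₀ f₀)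
    simpa only [h3] using h

end SphereACData

end SphereCR

end Literature.Geometry.Symplectic

end
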